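import Literature.MeasureTheory.Hausdorff.SphereArea
import Literature.MeasureTheory.Hausdorff.SphereRotationInvariance
import Literature.Geometry.Lorentzian.Basic
import Mathlib.Geometry.Manifold.PartitionOfUnity

/-!
# Route EIHFluxBalance — `LLBalanceLaw`: surface integrals over coordinate spheres of `E3`

Helper file for the support item `stmt-FinalStateConjecture-10189`
(`Summit.FinalStateConjecture.FinalStateConjecture.Theses.EIHFluxBalance.LLBalanceLaw`), whose two
integral clauses are taken, as everywhere in the Lorentzian files, against the Euclidean
(normalised) two-dimensional Hausdorff measure `σ = μHE[2]` of `E3 = ℝ³` restricted to a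
coordinate sphere `{|y − ξ| = R}`. This file supplies the measure theory on such spheres:

* translation to the origin (`setIntegral_sphere_euclideanHausdorff_add_right`,
  `setIntegral_shell_add_right`), finiteness of `σ` on spheres and integrability of continuous
  integrands (`euclideanHausdorff_sphere_lt_top`, `integrableOn_sphere_of_continuousOn`);
* **clause (v) of the item, the radius-averaging (spherical shell) formula**
  `∫_{ρ ∈ (R, 2R)} ∮_{|y − ξ| = ρ} f dσ dρ = ∫_{R < |y − ξ| < 2R} f(y) dy` for continuous `f`
  (`shellAverage`): spherical coordinates, through the tree's identification of `μHE[2]` on round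
  spheres with `ρ²` times the polar surface measure
  (`Hausdorff.setIntegral_sphere_euclideanHausdorff_three`) and polar coordinates on shells
  (`FluidPDE.setIntegral_shell_eq_integral_sphereIntegral`);
* **the flux of a spatial "curl" through a closed coordinate sphere vanishes**
  (`setIntegral_sphere_sum_fderiv_antisymm_eq_zero_of_contDiffOn`): for coefficients `A^{jl}`
  antisymmetric in `(j, l)` and `C¹` on a neighbourhood of the sphere,
  `∮ Σ_{j,l} ∂_l A^{jl}(y) (y − ξ)_j dσ(y) = 0`. This is the step "`∮ Σ_m ∂_m h^{μjm} n_j = 0` for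
  the spatial curl" of the Landau–Lifshitz balance law (LL §96, derivation of (96.16) from
  (96.11)); it needs the coefficients only NEAR THE SPHERE (no interior: black holes inside are
  allowed), because `Σ_{j,l} (y_j ∂_l − y_l ∂_j) A^{jl}` is a sum of derivatives along the rotation
  Killing fields `y_j ∂_l − y_l ∂_j`, each of which integrates to zero over a round sphere by the
  rotation invariance of `μHE[2]` (`Hausdorff.integral_sphere_fderiv_rotation_eq_zero`), after a
  smooth cutoff making the coefficients globally `C¹`.

Sources: Landau–Lifshitz, *The Classical Theory of Fields* §96 (key `LandauLifshitz1975`);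
Blanchet, Living Rev. Relativ., arXiv:1310.1528, §2.
-/

noncomputable section

open Set Metric Filter Module
open MeasureTheory MeasureTheory.Measure
open scoped Topology RealInnerProductSpace Manifold ContDiff

namespace Summit.FinalStateConjecture.FinalStateConjecture.Theorems

namespace LLBalance

open Literature.Geometry.Lorentzian

/-! ### Translation to the origin, finiteness, integrability -/

/-- `dim E3 = 2 + 1`, the shape of the dimension hypothesis of the Hausdorff sphere files.
[folklore] -/
theorem finrank_E3 : finrank ℝ E3 = 2 + 1 := by
  rw [finrank_euclideanSpace_fin]

/-- **Translation invariance of Hausdorff sphere integrals**: `∮_{|y − ξ| = r} f(y) dμHE[d](y) =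
∮_{|x| = r} f(x + ξ) dμHE[d](x)` (`μHE[d]` is invariant under the isometry `x ↦ x + ξ`).
[folklore] -/
theorem setIntegral_sphere_euclideanHausdorff_add_right {F : Type*} [NormedAddCommGroup F]
    [NormedSpace ℝ F] (d : ℕ) (ξ : E3) (r : ℝ) (f : E3 → F) :
    ∫ y in sphere ξ r, f y ∂(μHE[d] : Measure E3) =
      ∫ x in sphere (0 : E3) r, f (x + ξ) ∂(μHE[d] : Measure E3) := by
  have hmp : MeasurePreserving (fun x : E3 ↦ x + ξ) (μHE[d] : Measure E3) (μHE[d] : Measure E3) :=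
    (IsometryEquiv.addRight ξ).measurePreserving_euclideanHausdorffMeasure d
  have hme : MeasurableEmbedding (fun x : E3 ↦ x + ξ) := (Homeomorph.addRight ξ).measurableEmbedding
  have hpre : (fun x : E3 ↦ x + ξ) ⁻¹' sphere ξ r = sphere 0 r := by
    ext x
    simp [mem_sphere_iff_norm]
  rw [← hmp.setIntegral_preimage_emb hme f (sphere ξ r), hpre]

/-- **Translation invariance of shell integrals**: `∫_{a < |y − ξ| < b} f(y) dy =
∫_{a < |x| < b} f(x + ξ) dx` (Lebesgue measure is translation invariant). [folklore] -/
theorem setIntegral_shell_add_right {F : Type*} [NormedAddCommGroup F] [NormedSpace ℝ F]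
    (ξ : E3) (a b : ℝ) (f : E3 → F) :
    ∫ y in {y : E3 | a < dist y ξ ∧ dist y ξ < b}, f y =
      ∫ x in {x : E3 | a < ‖x‖ ∧ ‖x‖ < b}, f (x + ξ) := by
  have hmp : MeasurePreserving (fun x : E3 ↦ x + ξ) volume volume :=
    measurePreserving_add_right volume ξ
  have hme : MeasurableEmbedding (fun x : E3 ↦ x + ξ) := (Homeomorph.addRight ξ).measurableEmbedding
  have hpre : (fun x : E3 ↦ x + ξ) ⁻¹' {y : E3 | a < dist y ξ ∧ dist y ξ < b} =
      {x : E3 | a < ‖x‖ ∧ ‖x‖ < b} := by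
    ext x
    simp [dist_eq_norm]
  rw [← hmp.setIntegral_preimage_emb hme f _, hpre]

/-- **Coordinate spheres have finite area**: `μHE[2] {|y − ξ| = R} < ∞` (translate of the round
sphere about the origin, `Hausdorff.euclideanHausdorffMeasure_sphere_lt_top`). [folklore] -/
theorem euclideanHausdorff_sphere_lt_top (ξ : E3) (R : ℝ) :
    (μHE[2] : Measure E3) (sphere ξ R) < ⊤ := by
  have h := (IsometryEquiv.addRight ξ).image_sphere (0 : E3) R
  rw [IsometryEquiv.addRight_apply, zero_add] at h
  rw [← h, (IsometryEquiv.addRight ξ).isometry.euclideanHausdorffMeasure_image]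
  exact Literature.MeasureTheory.Hausdorff.euclideanHausdorffMeasure_sphere_lt_top finrank_E3 R

/-- **A function continuous on a coordinate sphere is integrable over it** (bounded on a compact
set of finite `μHE[2]`-measure). [folklore] -/
theorem integrableOn_sphere_of_continuousOn {F : Type*} [NormedAddCommGroup F] {G : E3 → F}
    {ξ : E3} {R : ℝ} (hG : ContinuousOn G (sphere ξ R)) :
    IntegrableOn G (sphere ξ R) (μHE[2] : Measure E3) := by
  obtain ⟨M, hM⟩ := (isCompact_sphere ξ R).exists_bound_of_continuousOn hG
  haveI : IsFiniteMeasure ((μHE[2] : Measure E3).restrict (sphere ξ R)) :=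
    ⟨by rw [Measure.restrict_apply_univ]; exact euclideanHausdorff_sphere_lt_top ξ R⟩
  refine ⟨hG.aestronglyMeasurable isClosed_sphere.measurableSet, ?_⟩
  refine HasFiniteIntegral.of_bounded (C := M) ?_
  exact (ae_restrict_iff' isClosed_sphere.measurableSet).2 (ae_of_all _ fun x hx ↦ hM x hx)

/-! ### Clause (v): averaging sphere integrals over the radius -/

/-- **Clause (v) of `LLBalanceLaw` — the radius-averaging lemma.** For a continuous `f : E3 → ℝ`,
`ξ ∈ E3` and `R > 0`,
`∫_{ρ ∈ (R, 2R)} ∮_{|y − ξ| = ρ} f dμHE[2] dρ = ∫_{R < |y − ξ| < 2R} f(y) dy`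
(spherical coordinates about `ξ`: `μHE[2]` on the sphere of radius `ρ` is `ρ²` times the polar
surface measure, `Hausdorff.setIntegral_sphere_euclideanHausdorff_three`, and Lebesgue measure on
the shell is `ρ² dρ dτ`, `FluidPDE.setIntegral_shell_eq_integral_sphereIntegral`). Landau–Lifshitz
§96; Blanchet, arXiv:1310.1528, §2. [cite: LandauLifshitz1975, §96] -/
theorem shellAverage (f : E3 → ℝ) (ξ : E3) (R : ℝ) (hR : 0 < R) (hf : Continuous f) :
    ∫ ρ in Ioo R (2 * R), ∫ y in sphere ξ ρ, f y ∂(μHE[2] : Measure E3) =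
      ∫ y in {y : E3 | R < dist y ξ ∧ dist y ξ < 2 * R}, f y := by
  have hE : finrank ℝ E3 = 3 := finrank_euclideanSpace_fin
  set g : E3 → ℝ := fun x ↦ f (x + ξ) with hg
  have hgc : Continuous g := hf.comp (continuous_id.add continuous_const)
  rw [setIntegral_shell_add_right ξ R (2 * R) f]
  have hint : IntegrableOn g {x : E3 | R < ‖x‖ ∧ ‖x‖ < 2 * R} volume := by
    refine (hgc.continuousOn.integrableOn_compact (isCompact_closedBall (0 : E3) (2 * R))).mono_set ?_
    intro x hx
    simpa using hx.2.le
  rw [Literature.Analysis.FluidPDE.setIntegral_shell_eq_integral_sphereIntegral volume hint hR.le, hE]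
  refine setIntegral_congr_fun measurableSet_Ioo fun ρ hρ ↦ ?_
  have hρ0 : 0 < ρ := hR.trans hρ.1
  rw [setIntegral_sphere_euclideanHausdorff_add_right 2 ξ ρ f,
    Literature.MeasureTheory.Hausdorff.setIntegral_sphere_euclideanHausdorff_three hE hρ0 g]

/-! ### The flux of a spatial curl through a closed coordinate sphere vanishes -/

/-- `⟪e_j, x⟫ = x_j` for the coordinate vectors `e_j = EuclideanSpace.single j 1` of `E3`.
[folklore] -/
theorem inner_single_one_left (j : Fin 3) (x : E3) :
    ⟪(EuclideanSpace.single j (1 : ℝ) : E3), x⟫ = x j := by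
  simp [EuclideanSpace.inner_single_left]

/-- **Killing fields kill antisymmetric fluxes on round spheres.** For coefficients
`B^{jl} : E3 → ℝ`, globally `C¹` and antisymmetric in `(j, l)`,
`∮_{|x| = R} Σ_{j,l} ∂_l B^{jl}(x) x_j dμHE[2](x) = 0`: by the Killing-field identity
`∮ DB(x)[x_j e_l − x_l e_j] dσ = 0` (`Hausdorff.integral_sphere_fderiv_rotation_eq_zero`) one has
`∮ x_j ∂_l B^{jl} = ∮ x_l ∂_j B^{jl} = −∮ x_l ∂_j B^{lj}`, so the double sum equals its own
negative. LL §96 ("the integral of a spatial curl over a closed surface vanishes").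
[cite: LandauLifshitz1975, §96 (96.16)] -/
theorem setIntegral_sphere_sum_fderiv_antisymm_eq_zero (B : Fin 3 → Fin 3 → E3 → ℝ)
    (hB : ∀ j l, ContDiff ℝ 1 (B j l)) (hanti : ∀ j l, B l j = fun x ↦ -B j l x) (R : ℝ) :
    ∫ x in sphere (0 : E3) R, ∑ j, ∑ l, fderiv ℝ (B j l) x (EuclideanSpace.single l 1) * x j
      ∂(μHE[2] : Measure E3) = 0 := by
  set e : Fin 3 → E3 := fun l ↦ EuclideanSpace.single l 1 with he
  -- every integrand below is continuous, hence integrable over the sphere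
  have hint : ∀ j l m k, IntegrableOn (fun x : E3 ↦ fderiv ℝ (B j l) x (e m) * x k) (sphere 0 R)
      (μHE[2] : Measure E3) := fun j l m k ↦
    integrableOn_sphere_of_continuousOn
      ((((hB j l).continuous_fderiv one_ne_zero).clm_apply continuous_const).mul
        (PiLp.continuous_apply 2 _ k)).continuousOn
  set I : Fin 3 → Fin 3 → ℝ := fun j l ↦
    ∫ x in sphere (0 : E3) R, fderiv ℝ (B j l) x (e l) * x j ∂(μHE[2] : Measure E3) with hI
  -- Step 1: interchange the integral with the finite sums
  have h1 : ∫ x in sphere (0 : E3) R, ∑ j, ∑ l, fderiv ℝ (B j l) x (e l) * x j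
      ∂(μHE[2] : Measure E3) = ∑ j, ∑ l, I j l := by
    rw [integral_finsetSum _ fun j _ ↦ integrable_finsetSum _ fun l _ ↦ hint j l l j]
    exact Finset.sum_congr rfl fun j _ ↦ integral_finsetSum _ fun l _ ↦ hint j l l j
  -- Step 2: the Killing-field identity `∮ x_j ∂_l B^{jl} = ∮ x_l ∂_j B^{jl}`
  have h2 : ∀ j l, I j l =
      ∫ x in sphere (0 : E3) R, fderiv ℝ (B j l) x (e j) * x l ∂(μHE[2] : Measure E3) := by
    intro j l
    by_cases hjl : j = l
    · subst hjl
      rfl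
    have hu : ‖e j‖ = 1 := by simp [he]
    have hv : ‖e l‖ = 1 := by simp [he]
    have huv : ⟪e j, e l⟫ = 0 := by
      simp [he, EuclideanSpace.inner_single_left, Ne.symm hjl]
    have hkill := Literature.MeasureTheory.Hausdorff.integral_sphere_fderiv_rotation_eq_zero
      finrank_E3 hu hv huv R (hB j l)
    have hlin : ∀ x : E3, fderiv ℝ (B j l) x (⟪e j, x⟫ • e l - ⟪e l, x⟫ • e j) =
        fderiv ℝ (B j l) x (e l) * x j - fderiv ℝ (B j l) x (e j) * x l := by
      intro x
      rw [map_sub, map_smul, map_smul, smul_eq_mul, smul_eq_mul, inner_single_one_left,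
        inner_single_one_left]
      ring
    simp_rw [hlin] at hkill
    rw [integral_sub (hint j l l j) (hint j l j l)] at hkill
    simp only [hI]
    linarith
  -- Step 3: antisymmetry `∮ x_l ∂_j B^{jl} = -∮ x_l ∂_j B^{lj} = -I^{lj}`
  have h3 : ∀ j l, ∫ x in sphere (0 : E3) R, fderiv ℝ (B j l) x (e j) * x l
      ∂(μHE[2] : Measure E3) = -I l j := by
    intro j l
    simp only [hI]
    rw [← integral_neg]
    refine integral_congr_ae (ae_of_all _ fun x ↦ ?_)
    simp only
    rw [hanti l j, fderiv_fun_neg]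
    simp
  -- Step 4: the double sum equals its own negative
  have h4 : ∑ j, ∑ l, I j l = -∑ j, ∑ l, I j l :=
    calc ∑ j, ∑ l, I j l = ∑ j, ∑ l, -I l j :=
          Finset.sum_congr rfl fun j _ ↦ Finset.sum_congr rfl fun l _ ↦ by rw [h2, h3]
      _ = -∑ l, ∑ j, I l j := by
          simp only [Finset.sum_neg_distrib]
          rw [Finset.sum_comm]
      _ = -∑ j, ∑ l, I j l := rfl
  rw [h1]
  linarith

/-- **Smooth cutoffs**: for `K` compact inside `O` open in `E3` there is a `C^∞` function `χ` with
`tsupport χ ⊆ O` and `χ = 1` on a neighbourhood of `K` (smooth Urysohn lemma,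
Mathlib's `exists_contMDiffMap_zero_one_nhds_of_isClosed` on `E3` as a manifold). [folklore] -/
theorem exists_contDiff_tsupport_subset_eventuallyEq_one {K O : Set E3} (hK : IsCompact K)
    (hO : IsOpen O) (hKO : K ⊆ O) :
    ∃ χ : E3 → ℝ, ContDiff ℝ ∞ χ ∧ tsupport χ ⊆ O ∧ ∀ᶠ z in 𝓝ˢ K, χ z = 1 := by
  obtain ⟨L, hL, hKL, hLO⟩ := exists_compact_between hK hO hKO
  obtain ⟨f, hf0, hf1, -⟩ :=
    exists_contMDiffMap_zero_one_nhds_of_isClosed (I := 𝓘(ℝ, E3)) (M := E3) (n := (⊤ : ℕ∞))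
      isOpen_interior.isClosed_compl hK.isClosed (disjoint_compl_left_iff_subset.2 hKL)
  have hsupp : Function.support (f : E3 → ℝ) ⊆ interior L := fun x hx ↦ by
    by_contra hx'
    exact hx (hf0.self_of_nhdsSet x hx')
  have htsupp : tsupport (f : E3 → ℝ) ⊆ L :=
    (closure_mono hsupp).trans (closure_minimal interior_subset hL.isClosed)
  exact ⟨f, contMDiff_iff_contDiff.1 f.contMDiff, htsupp.trans hLO, hf1⟩

/-- **Localisation is globally smooth**: if `g` is `Cⁿ` on an open `O` and `χ` is `Cⁿ` with
`tsupport χ ⊆ O`, then `χ · g` is `Cⁿ` on all of `E3` (near `O` a product of `Cⁿ` functions,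
elsewhere identically zero). [folklore] -/
theorem contDiff_cutoff_mul_of_contDiffOn {n : WithTop ℕ∞} {χ g : E3 → ℝ} {O : Set E3}
    (hO : IsOpen O) (hχ : ContDiff ℝ n χ) (hχO : tsupport χ ⊆ O) (hg : ContDiffOn ℝ n g O) :
    ContDiff ℝ n fun z ↦ χ z * g z := by
  rw [contDiff_iff_contDiffAt]
  intro z
  by_cases hz : z ∈ O
  · exact hχ.contDiffAt.mul (hg.contDiffAt (hO.mem_nhds hz))
  · have hz' : z ∉ tsupport χ := fun h ↦ hz (hχO h)
    have h0 : (fun w ↦ χ w * g w) =ᶠ[𝓝 z] fun _ ↦ 0 := by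
      filter_upwards [notMem_tsupport_iff_eventuallyEq.1 hz'] with w hw
      simp [hw]
    exact contDiffAt_const.congr_of_eventuallyEq h0

/-- **The flux of a spatial curl through a closed coordinate sphere vanishes.** Let
`A^{jl} : E3 → ℝ` (`j, l ∈ {1,2,3}`) be antisymmetric in `(j, l)` and `C¹` on an open set `V`
containing the coordinate sphere `{|y − ξ| = R}`. Then
`∮_{|y − ξ| = R} Σ_{j,l} ∂_l A^{jl}(y) (y − ξ)_j dμHE[2](y) = 0`
— only the coefficients near the sphere enter (smooth cutoff, translation to the origin, and
`setIntegral_sphere_sum_fderiv_antisymm_eq_zero`). This is the vanishing of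
`∮ Σ_m ∂_m h^{μjm} n_j dσ` in the Landau–Lifshitz balance law (LL §96, (96.11)–(96.16)).
[cite: LandauLifshitz1975, §96 (96.16)] -/
theorem setIntegral_sphere_sum_fderiv_antisymm_eq_zero_of_contDiffOn
    {A : Fin 3 → Fin 3 → E3 → ℝ} {V : Set E3} (hV : IsOpen V)
    (hA : ∀ j l, ContDiffOn ℝ 1 (A j l) V) (hanti : ∀ j l y, A l j y = -A j l y) {ξ : E3} {R : ℝ}
    (hS : sphere ξ R ⊆ V) :
    ∫ y in sphere ξ R, ∑ j, ∑ l, fderiv ℝ (A j l) y (EuclideanSpace.single l 1) * (y - ξ) j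
      ∂(μHE[2] : Measure E3) = 0 := by
  -- smooth cutoff equal to `1` near the sphere, supported in `V`
  obtain ⟨χ, hχ, hχV, hχ1⟩ :=
    exists_contDiff_tsupport_subset_eventuallyEq_one (isCompact_sphere ξ R) hV hS
  set A' : Fin 3 → Fin 3 → E3 → ℝ := fun j l y ↦ χ y * A j l y with hA'
  have hA'd : ∀ j l, ContDiff ℝ 1 (A' j l) := fun j l ↦
    contDiff_cutoff_mul_of_contDiffOn hV (hχ.of_le (by simp)) hχV (hA j l)
  have hA'anti : ∀ j l y, A' l j y = -A' j l y := fun j l y ↦ by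
    simp only [hA', hanti j l y, mul_neg]
  -- on the sphere the cutoff does not change derivatives
  have hfd : ∀ j l, ∀ y ∈ sphere ξ R, fderiv ℝ (A j l) y = fderiv ℝ (A' j l) y := by
    intro j l y hy
    refine (Filter.EventuallyEq.fderiv_eq ?_).symm
    filter_upwards [hχ1.filter_mono (nhds_le_nhdsSet hy)] with z hz
    simp [hA', hz]
  have hcongr : ∫ y in sphere ξ R, ∑ j, ∑ l, fderiv ℝ (A j l) y (EuclideanSpace.single l 1) *
      (y - ξ) j ∂(μHE[2] : Measure E3) = ∫ y in sphere ξ R, ∑ j, ∑ l,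
        fderiv ℝ (A' j l) y (EuclideanSpace.single l 1) * (y - ξ) j ∂(μHE[2] : Measure E3) := by
    refine setIntegral_congr_fun isClosed_sphere.measurableSet fun y hy ↦ ?_
    exact Finset.sum_congr rfl fun j _ ↦ Finset.sum_congr rfl fun l _ ↦ by rw [hfd j l y hy]
  rw [hcongr, setIntegral_sphere_euclideanHausdorff_add_right]
  simp only [add_sub_cancel_right]
  -- translate the coefficients to the origin
  set B : Fin 3 → Fin 3 → E3 → ℝ := fun j l x ↦ A' j l (x + ξ) with hB
  have hBd : ∀ j l, ContDiff ℝ 1 (B j l) := fun j l ↦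
    (hA'd j l).comp (contDiff_id.add contDiff_const)
  have hBanti : ∀ j l, B l j = fun x ↦ -B j l x := fun j l ↦ funext fun x ↦ hA'anti j l (x + ξ)
  have hBf : ∀ j l x, fderiv ℝ (A' j l) (x + ξ) = fderiv ℝ (B j l) x := fun j l x ↦ by
    simp only [hB, fderiv_comp_add_right]
  simp_rw [hBf]
  exact setIntegral_sphere_sum_fderiv_antisymm_eq_zero B hBd hBanti R

end LLBalance

end Summit.FinalStateConjecture.FinalStateConjecture.Theorems

end
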